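import Mathlib
import HarnessLib
import HarnessLib.Audit
import Summits.QuantumAdvantage.Statement
import Literature.Computability.Cryptography.ClassBQP
import Literature.Computability.Complexity.ProbabilisticClasses
import Literature.Computability.Complexity.Classes
import Literature.Barriers.QuantumAdvantage.BoundedEntanglement
import Literature.Computability.QuantumComplexity.SeparableCone
import Literature.Computability.QuantumComplexity.TreeProductFrames

/-!
Route: SeparableFrames

CLOSED (refuted) 2026-08-15T23:13:35Z by planner-rchoice-QuantumAdvantage-SeparableFram-5123992c-0 — reason: refuted:stmt-QuantumAdvantage-9863 (TwoQubitFrameExactness) by Summit.QuantumAdvantage.QuantumAdvantage.Theorems.SeparableFramesTwoQubitFrameExactness_refuted — note: route-choice (planner rchoice-5123992c): RETIRE. The frame mechanism 'unentangled => frame-certified => classically easy' is dead in every usable form: (1) exact kappa_2 = 1 (TwoQubitFrameExactness, stmt-9863) refuted by Theorems/SeparableFramesTwoQubitFrameExactnessRefutation (kappa_2 >= 43/40); (2. The file is kept as the record of this route; refuted decls are indexed as negative knowledge (`ledger negatives`).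

# Route SeparableFrames — Unentangled means frame-certified — the SEP-vs-adaptive-product-frame
dilation constant κ_n decides which one-clean-qubit witnesses of the summit can exist

It suffices to show X = OneCleanQubitHard: some language decided with bias 1/poly (threshold 1/2) by
classically generated
(FP) oracle-free Clifford+T circuits run on ONE clean qubit |0⟩ (wire 0, measured) and a maximally
mixed register — Knill–Laflamme's
DQC1 in Shor–Jordan's form (arXiv:0707.2831 p.3; now
`Literature.Computability.QuantumComplexity.IsDQC1Decidable`, X unfolds by rfl to
`∃ L, IsDQC1Decidable L ∧ L ∉ BPP`) — is not in BPP; with the support OneCleanQubitInBQP (DQC1 ⊆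
BQP, by rfl the named fact
`knillLaflamme1998_DQC1_subset_BQP`: purify the register with Bell pairs, universal circuit over the
FP description, majority vote) X gives
the summit by three lines of logic. X is HYPOTHESIS-TYPE (the open question "DQC1 ⊄ BPP", the horn
of card one-clean-qubit) and is never
staffed for direct proof.
What the route EARNS (spine card separable-frame-dilation) is the converse structure theory of X's
witnesses, Boyer–Brodutch–Mor's
dichotomy: crux SeparableInstancesInBPP — a one-clean-qubit family of ANY polarization α whose
trajectory never leaves the fully
separable cone decides only BPP languages, so every witness of X must entangle its register. At α =
1 and in the controlled-U
architecture this is Yoganathan–Cade's rigidity theorem (arXiv:1907.08224 Thm 3.4/3.5: every prefix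
unitary has a product eigenbasis;
Thm 4.9/4.10: DQC1sep ⊆ BPP by sampling the adaptive product eigenbasis); the route's content is α <
1 (BBM's reduced polarization) and
general circuits, reached through ONE scalar, the dilation constant κ_n := sup_T a(T)·s_sym(T)
between the symmetric separable body
𝒜_n = {A : I ± A fully separable} and the adaptive product-frame body 𝒫_n = conv(contractions
diagonal in LOCC-tree product bases) — crux
FrameDilationPolynomial "κ_n ≤ poly(n)", TYPED (2026-08-15 repair) over the landed
`fullySeparableCone` / `treeDiagonalContractions`; its
strong form R= "κ_n = 1" is REFUTED already at n = 2 (κ_2 ≥ 43/40: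
Theorems/SeparableFramesTwoQubitFrameExactnessRefutation.lean, the
former crux TwoQubitFrameExactness, now a settled negative edge and dropped) — plus the factor-2
lemma (support FactorTwoLemma: the
trace-estimation state ρ_α(U) is fully separable if I + 2α·Re(e^(−iθ)U) is for every θ, and only if
I + α·Re(e^(−iθ)U) is for every θ)
and frame tracking (crux FrameTrackingAlgorithm, TYPED: a family whose trajectory directions V_j Z₀
V_j† all carry tree frames of weight
≤ poly(|x|) decides only BPP languages — the α < 1, weight > 1 extension of Yoganathan–Cade's
eigenvector-sampling simulation).
Lean: `∃ L : Language Bool, (∃ (k : List Bool → ℕ) (C : (x : List Bool) →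
Literature.Computability.Cryptography.QCircuit Literature.Computability.Cryptography.cliffordT (1 +
k x)), (∀ x, (C x).IsOracleFree) ∧ (fun x : List Bool =>
Literature.Computability.Cryptography.QCircuit.sigmaEncode (G :=
Literature.Computability.Cryptography.cliffordT) ⟨1, k x, C x⟩) ∈
Literature.Computability.Complexity.FP ∧ (∃ q : Polynomial ℕ, ∀ x : List Bool, (x ∈ L → (1 : ℝ) / 2
+ 1 / (((q.eval x.length : ℕ) : ℝ) + 1) ≤ (∑ r : Literature.Computability.Cryptography.QReg (k x),
((1 : ℝ) / 2 ^ (k x)) * (C x).probEvent 0 (Literature.Computability.Cryptography.basisState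
(Fin.append (fun _ : Fin 1 => false) r)) (Literature.Computability.Cryptography.QCircuit.acceptEvent
(1 + k x)))) ∧ (x ∉ L → (∑ r : Literature.Computability.Cryptography.QReg (k x), ((1 : ℝ) / 2 ^ (k
x)) * (C x).probEvent 0 (Literature.Computability.Cryptography.basisState (Fin.append (fun _ : Fin 1
=> false) r)) (Literature.Computability.Cryptography.QCircuit.acceptEvent (1 + k x))) ≤ (1 : ℝ) / 2
- 1 / (((q.eval x.length : ℕ) : ℝ) + 1)))) ∧ L ∉ Literature.Computability.Complexity.BPP`

## Assembly
Pure logic (sorry-free `closes`, axioms propext, Classical.choice, Quot.sound; unchanged by the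
2026-08-15 repair): OneCleanQubitHard supplies
L with its one-clean-qubit decider and L ∉ BPP; OneCleanQubitInBQP puts the same L in BQP; ⟨L, ·, ·⟩
witnesses
QuantumAdvantage = ∃ L ∈ BQP, L ∉ BPP. The ranked cruxes are the converse programme (which
one-clean-qubit witnesses CAN exist:
only entangling ones, if SeparableInstancesInBPP holds) and are deliberately not hypotheses of
`closes`; their internal wiring —
FrameDilationPolynomial ∧ FrameTrackingAlgorithm ∧ FactorTwoLemma ⟹ SeparableInstancesInBPP
(separable trajectory ⇒ radius ≥ α ⇒ tree
frames of weight ≤ κ_n/α ≤ poly ⇒ BPP) — is recorded in § Two-layer plan; the refuted n = 2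
exactness rung is no longer part of it.

Rationale: WHY THIS LINE. The tree's entanglement-necessity theorem is PROVED
(`Literature.Barriers.QuantumAdvantage.jozsaLinden2003_pblocked_holds`:
pure p-blocked trajectories decide only BPP languages) and its one declared evasion is mixed
separable computation (Jozsa–Linden
arXiv:quant-ph/0201143 §5), posed sharply for one clean qubit by Datta–Flammia–Caves
(arXiv:quant-ph/0505213 p.4, p.16) and
Boyer–Brodutch–Mor (arXiv:1606.05283 p.8: "find a family of DQC1 circuits which encode classically
hard computational problems and
… do not generate any entanglement …; or conversely … an algorithm that can simulate any separable
instance of DQC1"), and SETTLED at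
polarization α = 1 for the controlled-U architecture by Yoganathan–Cade (arXiv:1907.08224, read pp.
3–5, 12, 24: Thm 3.4/3.5 — every
prefix unitary must have a product eigenbasis; Thm 4.9/4.10 — DQC1sep ⊆ BPP by sampling the adaptive
product eigenbasis; Conj. 6.1/6.2
— the general mixed-state question). This route types BBM's horn (SeparableInstancesInBPP, all α ∈
[0,1], general circuits) under the
same proved theorem and attacks the α < 1 regime, where rigidity is replaced by one imported object.
Imported area: convex geometry of
the separable cone / restricted-measurement norms (Matthews–Wehner–Winter arXiv:0810.2327 Lemma 2,
Remark 3, Thm 4: 𝒜_n is the SEP body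
and κ_n a constant of domination; Lancien–Winter arXiv:1206.2884; Chitambar–Hsieh arXiv:1311.1536
§3; Chitambar–Duan–Hsieh
arXiv:1308.1737 Lemma 10) with an explicit dictionary: a tree-frame decomposition T = Σ c_k D_k of
weight Σ|c_k| ≤ A IS an unbiased
estimator of tr(Tρ) of ℓ1-weight A from adaptive single-qubit measurement statistics, and on the
maximally mixed register those
statistics are fair coins, so a(T) ≤ poly makes tr U/2^n ± ε a BPP quantity, while s_sym(T) ≥ 1/a(T)
always — κ_n measures exactly
the room between "unentangled" and "frame-certified, hence classically easy" (at α = 1 that room is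
empty: Yoganathan–Cade's product
eigenbases are weight-1 tree frames). The factor-2 lemma (FactorTwoLemma) makes "separable instance
of DQC1_α" a statement about
s_sym of the prefix directions Re(e^(−iθ)U_k). REPAIR 2026-08-15: the n = 2 exactness rung
TwoQubitFrameExactness ("κ_2 = 1",
𝒜_2 = 𝒫_2) is REFUTED (Theorems/SeparableFramesTwoQubitFrameExactnessRefutation.lean: X-state A with
1 ± A explicitly separable and
Re tr((1 − |χ⟩⟨χ|)A) = 43/8 > 5 ≥ the value on every tree contraction, χ = 2|00⟩ + |11⟩; κ_2 ≥
43/40, numerically ≈ 1.09–1.11) — the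
SEP-vs-LOCC strictness of Chitambar–Duan–Hsieh Lemma 10 already at two qubits; it was never a
hypothesis of `closes`, is dropped as an
item and kept as a settled negative edge, and the line continues in its pre-announced polynomial
form (κ_n ≤ poly(n)), now TYPED
because the requested definitions landed
(`Literature.Computability.QuantumComplexity.fullySeparableCone`, `treeDiagonalContractions` /
`treeFrameNorm` / `symmRadius`, `IsDQC1Decidable` / `DQC1` / fact
`knillLaflamme1998_DQC1_subset_BQP`). No other open route touches mixed-state
separability or DQC1; the negatives index (3 entries: KummerSector, ShorLocallyDark, and this
route's own κ_2 = 1) is respected — nothing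
here restates 𝒜_2 = 𝒫_2 or a reworded exactness claim.

RANKED CRUXES. #0 OneCleanQubitHard (target) — HYPOTHESIS-TYPE ("DQC1 ⊄ BPP", Knill–Laflamme 1998 /
Shor–Jordan 2008 p.3 form; = `∃ L, IsDQC1Decidable L ∧ L ∉ BPP` by rfl): there are a language L ∉
BPP, a register size k(x) and oracle-free Clifford+T circuits C_x on 1 + k(x) wires with x ↦ ⟨1,
k(x), C_x⟩ computable in FP, and a polynomial q, such that the one-clean-qubit acceptance
probability — wire 0 prepared |0⟩, wires 1…k(x) maximally mixed (uniform average over basis inputs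
r), run C_x, measure wire 0 — is ≥ 1/2 + 1/(q(|x|)+1) on x ∈ L and ≤ 1/2 − 1/(q(|x|)+1) on x ∉ L.
Never staffed for direct proof. (why it might fail: Hypothesis-type: implies S, hence PP ⊄ BPP
(SeparationPrerequisites). Decision-DQC1 may sit in BPP while multiplicative DQC1 SAMPLING stays
PH-hard; no classical trace estimator is known for general U, none is excluded.)
[arXiv:quant-ph/9802037, arXiv:0707.2831, arXiv:quant-ph/0505213, arXiv:1711.10605]
#2 SeparableInstancesInBPP (crux) — BOYER–BRODUTCH–MOR'S HORN (the mixed-state, one-clean-qubit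
counterpart of the proved jozsaLinden2003_pblocked): for every polarization α ∈ [0,1], every
FP-generated oracle-free Clifford+T one-clean-qubit family (wire 0 prepared (1+α)/2·|0⟩⟨0| +
(1−α)/2·|1⟩⟨1|, wires 1…k(x) maximally mixed) ALL of whose trajectory states — every input x, after
every prefix of j gates — lie in the FULLY SEPARABLE cone (`IsPBlocked 1` combinations =
`fullySeparableCone` by Iff.rfl) decides, with bias 1/poly around 1/2, only languages in BPP. Known
slice: α = 1 with C_x of controlled-U form (Yoganathan–Cade Thm 4.10); open: α < 1 (BBM) and general
circuits at every α (their Conj. 6.1 is the pure-ancilla analogue). [deps: FrameDilationPolynomial,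
FrameTrackingAlgorithm, FactorTwoLemma] [difficulty: open-problem] (why it might fail: BBM's open
dichotomy; DQC1 power is usually credited to discord, not entanglement (DFC: separable speed-up 'not
demonstrated impossible'); and the frame certificate provably leaks already at n = 2 (κ_2 ≥ 43/40),
so holistically separable directions with no light frame may carry hard traces.) [arXiv:1606.05283,
arXiv:1907.08224, arXiv:quant-ph/0505213, arXiv:0709.0548, arXiv:quant-ph/0201143, arXiv:1308.1737]
#3 FrameDilationPolynomial (crux; TYPED 2026-08-15, replaces the informal stmt-9882 and absorbs the
refuted n = 2 rung) — κ_n ≤ poly(n) in witness form: there is a polynomial p such that for every n,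
every operator T on n qubits and every β > 0 with 1 + βT and 1 − βT both in `fullySeparableCone n`,
T is a real combination Σ c_m D_m of `treeDiagonalContractions n` (real-diagonal contractions in
adaptive LOCC-tree orthonormal product bases) with β·Σ|c_m| ≤ p(n). Equivalently 𝒜_n ⊆ p(n)·𝒫_n,
i.e. ‖·‖_SEP ≤ p(n)·‖·‖_tree on every functional. Known: κ_1 = 1; 43/40 ≤ κ_2 ≤ 4 (Pauli sectors);
κ_n ≤ 4^n always (Pauli ℓ1); the strong form κ_n = 1 is refuted. [difficulty: L/open] (why it might
fail: 𝒜 is closed under ⊗ (1 + A⊗A′ = ½[(1+A)⊗(1+A′) + (1−A)⊗(1−A′)]), so the certified n = 2 gap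
tensorises: κ_2m ≥ (43/8)^m / h_𝒫(W^⊗m); unless adaptive trees gain collectively on copies of the
X-state witness, κ_n ≥ 1.075^(n/2).) [arXiv:0810.2327, arXiv:1206.2884, arXiv:1311.1536,
arXiv:1308.1737, arXiv:1406.1959,
Summit.QuantumAdvantage.QuantumAdvantage.Theorems.SeparableFramesTwoQubitFrameExactness_refuted]
#4 FrameTrackingAlgorithm (crux; TYPED 2026-08-15, replaces the informal stmt-9893; decision form of
"constructive frame tracking", the algorithm BBM ask for) — for every α ∈ [0,1] and every
FP-generated oracle-free Clifford+T family C_x on 1 + k(x) wires: IF there is a polynomial p such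
that for every input x and every prefix j the trajectory direction T_(x,j) := Σ_b Σ_r (−1)^b
|V_j(b·r)⟩⟨V_j(b·r)| = V_j Z₀ V_j† (V_j = the first j gates, run on basis inputs; the α-independent
part of the trajectory state (1 + α T_(x,j))/2^(k+1)) admits a tree-frame decomposition of weight ≤
p(|x|), THEN the language decided at polarization α with bias 1/(q+1) is in BPP. At α = 1 in the
controlled-U architecture with weight-1 frames this is Yoganathan–Cade's eigenvector-sampling
simulation (Thm 4.10); the claim is its extension to weight ≤ poly and any α, where the machine must
FIND the frames from the gate list (one local update per 2-qubit gate — the mixed-state analogue of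
Jozsa–Linden re-blocking / Harrow–Nielsen Carathéodory updates). [difficulty: L] (why it might fail:
Existence-only promise: light frames along the trajectory may exist yet be hard to find (tree bases
form a non-convex family), and prefix weight ≤ poly is weaker than the per-gate ℓ1 products
Pauli-path samplers need (arXiv:2409.01706); the bet is gate-local re-framing.) [arXiv:1907.08224,
arXiv:1606.05283, arXiv:quant-ph/0301108, arXiv:2409.01706, arXiv:2306.04797]
#9 FactorTwoLemma (support) — FACTOR-2 TIGHTNESS (provable now; re-derived on paper by three refuter
seats): with ρ_α(U) := (1/(2·2^m))·[[I, αU†],[αU, I]] (the trace-estimation state after H and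
controlled-U at polarization α, clean qubit = wire 0) and T_θ := Re(e^(−iθ)U): (i) I + 2α·T_θ fully
separable for every θ ⇒ ρ_α(U) fully separable (four-angle average); (ii) ρ_α(U) fully separable ⇒ I
+ α·T_θ fully separable for every θ (project wire 0 onto (|0⟩ + e^(iθ)|1⟩)/√2;
`contractHead_mem_fullySeparableCone`). Hence 'separable instance' ⟺ s_sym of every prefix direction
≥ α up to the factor 2. [difficulty: provable-now] [arXiv:1606.05283, arXiv:quant-ph/0505213,
doi:10.1103/PhysRevLett.83.1054, arXiv:quant-ph/0409095]
#9 OneCleanQubitInBQP (support) — THE BRIDGE (DQC1 ⊆ BQP, Knill–Laflamme 1998; Shor–Jordan 2008 §1):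
every language decided in the one-clean-qubit model of the target is in `BQP`; by `Iff.rfl` this is
the named Literature fact
`Literature.Computability.QuantumComplexity.knillLaflamme1998_DQC1_subset_BQP` (vendored p49450:
purification by Bell halves, universal circuit over the FP description with exact Clifford+T
gadgets, Chernoff majority). A theorem in print, XL to formalise; shares infrastructure with route
Shor's P ⊆ BQP crux. [difficulty: XL] [KnillLaflamme1998, ShorJordan2008, arXiv:1212.0506,
BernsteinVazirani1997]
SETTLED NEGATIVE EDGE (not an item any more): TwoQubitFrameExactness (stmt-QuantumAdvantage-9863,
rank 3 at open) — REFUTED by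
Summit.QuantumAdvantage.QuantumAdvantage.Theorems.SeparableFramesTwoQubitFrameExactness_refuted
(refuted-substantive: no cheap repair of 𝒜_2 = 𝒫_2; the true variants 'κ_2 ≤ c' and 'every Hermitian
unitary in 𝒜_2 is a tree reflection' are the n = 2 instances of FrameDilationPolynomial resp. of
Yoganathan–Cade rigidity and are left to provers as `--supports FrameDilationPolynomial` lemmas,
never re-filed).

TWO-LAYER PLAN. Foreseen glued split (nothing filed now): SeparableInstancesInBPP ⇐ OneSidedDilation
→ FrameTrackingAlgorithm → SeparableInstancesInBPP,
where OneSidedDilation (support, to be typed when the split is made) says: if the trajectory state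
(1 + α T_(x,j))/2^(k+1) is fully
separable then T_(x,j) = V_j Z₀ V_j† has a tree frame of weight ≤ poly(k)/α. For the controlled-U
(trace-estimation) architecture
OneSidedDilation is exactly FactorTwoLemma (ii) + FrameDilationPolynomial applied to the prefix
directions Re/Im(e^(−iθ)U_k) (two-sided
radius ≥ α ⇒ a ≤ κ/α, and X₀ ⊗ Re U + Y₀ ⊗ Im U is tree-diagonal once Re U, Im U are, wire 0
measured first); for general circuits the
one-sided radius of the Hermitian unitary V_j Z₀ V_j† must be related to the two-sided one — the
first support lemma of that split.
FrameDilationPolynomial itself is no longer split through an n = 2 base case (κ_2 > 1 makes a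
multiplicative induction exponential); its
natural children are (a) a TENSOR-STABILITY statement "h_𝒫 is super-multiplicative enough on tensor
powers: h_𝒫(W^⊗m) ≥ h_𝒜(W)^m/poly(m)"
and (b) a bounded-width reduction; k ≤ 3, depth 1, filed only after FrameTrackingAlgorithm or
SeparableInstancesInBPP moves.

KILL CRITERIA. - TwoQubitFrameExactness IS refuted (2026-08-15; class substantive for the exactness
claim) — the pre-announced pivot is executed: R= is dead,
FrameDilationPolynomial lives in polynomial form only, the route stays open on it. A refutation of
FrameDilationPolynomial (κ_n superpolynomial —
the cheapest road is now the TENSOR POWER of the certified n = 2 witness: 𝒜 is ⊗-closed, so κ_2m ≥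
(43/8)^m / h_𝒫(W^⊗m), and it suffices to
show adaptive trees gain nothing super-polynomial collectively on W^⊗m; alternatives: UPB / Shifts
tensor powers, Chitambar–Hsieh-type
strictness, Aubrun–Lancien generic SEP-vs-LOCC gaps arXiv:1406.1959) kills the frame mechanism as a
COMPLETE certificate of separable
instances: if FrameTrackingAlgorithm is also dead, close `refuted:FrameDilationPolynomial` with the
census "holistically separable directions
exist: the only place an entanglement-free DQC1 witness can live" handed to card one-clean-qubit and
the refuters; if FrameTrackingAlgorithm
survives, pivot SeparableInstancesInBPP to the frame-certified subclass (it then IS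
FrameTrackingAlgorithm's conclusion) and re-thesis.
- FrameTrackingAlgorithm refuted AS TYPED by a family with light-but-unfindable frames
(cryptographic planting) ⇒ restate with a constructive
promise (frames FP-computable from x, j), not a kill; refuted by a Pauli-path variance obstruction
on a natural family ⇒ substantive, pivot to
the Pauli-sparse subclass or close.
- SeparableInstancesInBPP refuted outright would exhibit a separable-trajectory family deciding a
non-BPP language — that PROVES the summit (hand
to the S-side at once); refuted AS TYPED (model slip: weights, wire conventions, FP encoding) ⇒
restate, not a kill.
- OneCleanQubitHard is hypothesis-type: a proof of DQC1 ⊆ BPP (¬X, a major dequantisation, not ¬S)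
closes the route `refuted:OneCleanQubitHard`;
OneCleanQubitInBQP failing as typed ⇒ re-type against `IsDQC1Decidable`. QuantumAdvantage proved
elsewhere moots the route.

NOT DECOMPOSED YET. Deliberately left below the item layer (provers attach them with `--supports
<Decl>`): the n = 2 constant (43/40 ≤ κ_2 ≤ 4;
sharp value ≈ 1.1?) and the true n = 2 variants of the refuted rung ('κ_2 ≤ c'; 'Hermitian unitaries
in 𝒜_2 are tree reflections' =
Yoganathan–Cade Lemma 4.6-type rigidity) as supports of FrameDilationPolynomial; the exact families
(Bell-diagonal, Werner/isotropic, GHZ_n: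
ratio 1 by hand, card P2); the toy separation D_CNOT ⊋ F_CNOT (card P3); the PPT ceiling h_𝒜 ≤ min
Σ‖W_S^(Γ_S)‖₁; the effective profile κ_n(σ)
over IMPLEMENTABLE directions (card K3); OneSidedDilation and the tensor-stability child of
FrameDilationPolynomial (§ Two-layer plan);
uniformity/encoding plumbing of OneCleanQubitInBQP; the equivalence of the typed single-run-bias
model with repetition-based DQC1 and with
DQC1_α for 1/poly ≤ α ≤ 1; a restatement of OneCleanQubitHard / OneCleanQubitInBQP /
SeparableInstancesInBPP through `IsDQC1Decidable` /
`fullySeparableCone` (pure renamings by rfl — to be done only together with card one-clean-qubit's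
route so the target is shared by
signature, not as churn now).

CHEAPEST FALSIFIER. For FrameDilationPolynomial (the line's load-bearing geometric claim): the
TENSOR-SQUARE TEST of the certified n = 2 witness —
on 4 qubits take W₂ = W ⊗ W with W = 1 − |χ⟩⟨χ|, χ = 2|00⟩ + |11⟩ (h_𝒜(W) ≥ 43/8, h_𝒫(W) = 5, both
certified in
Theorems/SeparableFramesTwoQubitFrameExactnessRefutation.lean); h_𝒜(W₂) ≥ (43/8)² = 28.89 for free
(𝒜 is ⊗-closed), product trees give
h_𝒫(W₂) ≥ 25; maximise Σ_y |⟨e_y|W₂|e_y⟩| over ALL 4-qubit adaptive trees (first wire ∈ 4,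
conditional wires and bases at depth 2–3, last
level in closed form = trace norm of the conditional 2×2 block: 14 real angles × ≤ 576 wire
patterns, multistart) — a kit job of minutes with
the refuters' existing kappa2 scripts (evidence kappa2_verify.py on stmt-9863). Outcome h_𝒫(W₂) =
25.00 (no collective gain) is strong evidence
that the gap is multiplicative, κ_2m ≥ 1.075^m, and FrameDilationPolynomial is headed for `refuted:`
(then § Kill criteria, bullet 1);
h_𝒫(W₂) close to 28.9 keeps the polynomial form alive and re-ranks it up. For
FrameTrackingAlgorithm: the Pauli special case — a
Clifford+T family with prefix Pauli-ℓ1 ≤ poly but exponentially many Pauli paths (e.g. T-gates whose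
contributions cancel in prefix sums):
does importance-sampled Pauli propagation (arXiv:2409.01706, arXiv:2306.04797) still estimate tr(Z₀
T_T)/2^(k+1) to 1/poly? A 'no' on paper
is a misstatement warning for the existence-only promise.

NUMBERS. κ_1 = 1 (Σ w_i|⟨φ_i|W|φ_i⟩| ≤ ‖W‖₁). n = 2 (SETTLED 2026-08-15): κ_2 ≥ 43/40 = 1.075
certified in Lean (X-state direction
A = [[−5/8,0,0,−3/4],[0,1/4,0,0],[0,0,1/4,0],[−3/4,0,0,1/2]], functional 1 − |χ⟩⟨χ|); ≥ 1.073 by an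
independent rational certificate and
≈ 1.106 numerically (refuter g41-28, ε-net + Lipschitz bound); analytic family W = αI − |ψ⟩⟨ψ|, ψ =
cos t|00⟩ + sin t|11⟩, α ≤ sin²t with
h_𝒜/h_𝒫 = 1 + 2α(1 − sin 2t), up to ≈ 1.09 (g41-59); random W show 7–10 % gaps routinely, while
Werner/isotropic, Bell-diagonal, SWAP and
maximally entangled directions have NO gap (which is why the card's 62-direction survey, j000507,
read 1.000 ± 0.003); toy bound κ_2 ≤ 4
(Pauli sectors, Cauchy–Schwarz); κ_n ≤ 4^n always. n = 3 (card data, column generation unconverged):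
GHZ₃ ratio 1; Shifts-UPB direction a·s ≈ 0.99–1.13; random directions a·s_cg =
1.06–1.14 with duals 1.21–1.27 (j000632/j000633).
Thresholds in print: no clean|register entanglement iff α ≤ 1/2 and PPT-from-spectrum at 2^(−n/2)
(arXiv:1606.05283 pp.5–8); BCJLPS
separable ball η ≤ 1/(1 + 2^(2n−1)), entangled pseudo-pure states at 1/(1 + 2^(n−1))
(doi:10.1103/PhysRevLett.83.1054); general
SEP-vs-LOCC-norm domination bounds are exponential in the number of parties (arXiv:1206.2884). Items
after repair: 7 typed (target,
assembly, 3 cruxes, 2 supports), 0 informal; 1 settled negative edge.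

DEFINITION REQUESTS. LANDED 2026-08-15 (no open requests):
`Literature.Computability.QuantumComplexity.fullySeparableCone n` (+ `IsSeparableState`,
cone API incl. `tensorHead`/`conjHead`/`contractHead` stability, `one_mem_fullySeparableCone`) in
SeparableCone.lean — by `Iff.rfl` the inline
`IsPBlocked 1` condition of SeparableInstancesInBPP / FactorTwoLemma; `IsQubitONB`,
`IsTreeProductBasis n`, `frameDiagonal`,
`treeDiagonalContractions n`, `treeFrameBody n` (= 𝒫_n), `atomicGauge`, `treeFrameNorm` (= a(T)),
`symmRadius K T` (s_sym = `symmRadius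
(fullySeparableCone n)`) in TreeProductFrames.lean — FrameDilationPolynomial /
FrameTrackingAlgorithm are typed in the WITNESS form the file
recommends (explicit decompositions, no sInf/iSup junk values); `IsDQC1Decidable`, `DQC1`, fact
`knillLaflamme1998_DQC1_subset_BQP` in
OneCleanQubit.lean (target and bridge unfold to them by rfl). Still wanted as cite facts only if a
prover needs them as hypotheses:
Matthews–Wehner–Winter Lemma 2 / Thm 4 (arXiv:0810.2327); Walgate–Hardy Thm 3–4
(arXiv:quant-ph/0202034: tree bases = all two-qubit
orthonormal product bases); Peres–Horodecki 2⊗2; Yoganathan–Cade Thm 3.4 / 4.10 (arXiv:1907.08224)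
for the α = 1 slice.

DEGENERATE CASES CHECKED. FrameDilationPolynomial: β > 0 is required (β = 0 would demand a real tree
decomposition of a non-Hermitian T);
with β > 0 the hypotheses force T Hermitian and every Hermitian T has a Pauli (hence tree)
decomposition, so the content is the weight
bound only; T = 0 takes the empty decomposition; n = 0, 1 hold with p ≥ 1. FrameTrackingAlgorithm: α
= 0 makes the bias hypothesis
unsatisfiable (acceptance ≡ 1/2) — vacuous there, like SeparableInstancesInBPP; k(x) = 0 satisfies
the promise with p = 1 and the
conclusion holds (exact 2×2 arithmetic over ℤ[1/√2, i]: L ∈ P); j = 0 gives T = Z₀ ⊗ 1 (weight 1);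
Clifford families give Pauli directions
and Gottesman–Knill deciders, consistent. Both new decls elaborate with the route's imports +
SeparableCone/TreeProductFrames (Sketch.lean
rc 0, 0 sorries); `OneCleanQubitInBQP ↔ knillLaflamme1998_DQC1_subset_BQP` and `OneCleanQubitHard ↔
∃ L, IsDQC1Decidable L ∧ L ∉ BPP` by `Iff.rfl`.

Novelty: Searches (2026-08-15, this session): `lit search --hybrid "one clean qubit DQC1 separable classical
simulation entanglement necessary"`
(12 book rows: Bengtsson–Życzkowski pp.442–635, Cuffaro–Fletcher 2018 pp.41/130, Nielsen–Chuang — no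
frame/estimator duality);
`lit galaxy search "one clean qubit" --star all` (20 rows: Ambainis–Schulman–Vazirani
quant-ph/0003136, Morimae's two textbooks,
Cade–Crichigno 2107.00011, Bouland–Mančinska–Zhang 1602.04145 — none on separability certificates);
`lit galaxy search "entanglement and
the power of one qubit" --star pdf` (0); `lit frontier QuantumAdvantage --since 2021` (30 rows, none
on DQC1 / separability); `lit read`
arXiv:0707.2831 p.3 (the typed DQC1 model: threshold 1/2, bias 1/poly, classically generated
circuits, O(log) clean qubits), arXiv:quant-ph/0202034
pp.3–4 (Thm 3–4: two-qubit orthogonal product bases are one-way LOCC = tree bases); the remote paper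
cascade timed out once (rc 75);
plus the card's searches (163 cards grepped: 0 'separable') and the novelty audit's reads
(arXiv:0810.2327 Lemma 2 / Remark 3 / Thm 4,
arXiv:1311.1536 §3, arXiv:1206.2884).
Nearest prior art found: arXiv:0810.2327 (Matthews–Wehner–Winter: restricted-measurement norms; 𝒜_n
is the SEP body and κ_n a domination
constant — the framework, without the DQC1 reading); arXiv:1606.05283 p.8 with
arXiv:quant-ph/0505213 (the dichotomy posed; spectrum-only
PPT criteria; threshold 2^(−n/2)); arXiv:quant-ph/0301108 (Harrow–Nielsen pointwise separable-gate
simula  [refs: 0707.2831, quant-ph/0202034, 0810.2327, 1311.1536, 1206.2884, 1606.05283, quant-ph/0505213, quant-ph/0301108]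

Barriers (technique_class: simulation, resource-necessity, convex-geometry): - technique_class: simulation, resource-necessity, convex-geometry
- Literature.Barriers.QuantumAdvantage.SeparationPrerequisites: it does not evade it — the summit
arrow is the hypothesis-type target OneCleanQubitHard (X ⟹ S ⟹ PP ⊄ BPP), never staffed; the earned
items constrain witnesses and claim no separation.
- Literature.Barriers.QuantumAdvantage.Relativization: the earned statements are white-box (explicit
gate lists, convex-geometric identities on the separable cone) and non-relativizing in kind, as
Gottesman–Knill and the proved jozsaLinden2003_pblocked are; the target inherits the barrier exactly
as S does.
- Literature.Barriers.QuantumAdvantage.Algebrization: same status as Relativization; nothing is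
arithmetised.
- Literature.Barriers.QuantumAdvantage.NaturalProofs: n/a — no circuit lower bound or constructive
largeness predicate is used.
- Literature.Barriers.QuantumAdvantage.NoiseThresholdUpperBounds: polarization α is one-qubit purity
at ZERO gate noise and the criterion is U-specific (s_sym of Re(e^(−iθ)U)), not a universal rate;
the barrier's fault-tolerance thresholds are not engaged.
- Literature.Barriers.QuantumAdvantage.TotalFunctionSpeedupLimit: n/a (no oracle / query problem);
likewise RandomOracleMethod, PPolyOracles and SupremacyTheoremsNonRelativizing (PH-collapse results
for DQC1 concern multiplicative SAMPLING and are silent on the decision target).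
- BoundedEntanglement file (Jozsa–Linden; a BARRIER block of the catalogue directory, not a catalogu

History (route lifecycle, newest last):
- 2026-08-15T15:35:05Z · BROKEN — TwoQubitFrameExactness (stmt-QuantumAdvantage-9863, crux) refuted by Summit.QuantumAdvantage.QuantumAdvantage.Theorems.SeparableFramesTwoQubitFrameExactness_refuted @ f92389067068 (refuter-refute-pool-g41-14)
- 2026-08-15T18:22:53Z · rev 2: dropped TwoQubitFrameExactness, stmt-QuantumAdvantage-9882, stmt-QuantumAdvantage-9893 — repair: TwoQubitFrameExactness (stmt-QuantumAdvantage-9863, 'κ_2 = 1') refuted-substantive by Summit.QuantumAdvantage.QuantumAdvantage.Theorems.SeparableFramesT (planner-rfix-QuantumAdvantage-SeparableFrame-7abad01b-0)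
- 2026-08-15T18:22:54Z · REPAIRED (drop TwoQubitFrameExactness, stmt-QuantumAdvantage-9882, stmt-QuantumAdvantage-9893; add FrameDilationPolynomial, FrameT) — back to open: repair: TwoQubitFrameExactness (stmt-QuantumAdvantage-9863, 'κ_2 = 1') refuted-substantive by Summit.QuantumAdvantage.QuantumAdvantage.Theorems.SeparableFramesT (planner-rfix-QuantumAdvantage-SeparableFrame-7abad01b-0)
- 2026-08-15T23:13:35Z · CLOSED refuted — refuted:stmt-QuantumAdvantage-9863 (TwoQubitFrameExactness) by Summit.QuantumAdvantage.QuantumAdvantage.Theorems.SeparableFramesTwoQubitFrameExactness_refuted (planner-rchoice-QuantumAdvantage-SeparableFram-5123992c-0)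

sub-problem: QuantumAdvantage · status: closed(refuted) · opened planner-plancard-QuantumAdvantage-QuantumAdva-59bff533-0 2026-08-15T14:42:30Z · rev 2 · ledger route-QuantumAdvantage-SeparableFrames
GENERATED by the gate from the ledger (D-0016/17). Provers cite these decls: `theorem foo : Summit.QuantumAdvantage.QuantumAdvantage.Theses.SeparableFrames.<Decl> := …` in Summits/QuantumAdvantage/QuantumAdvantage/Theorems/<Name>.lean.
-/

namespace Summit.QuantumAdvantage.QuantumAdvantage.Theses.SeparableFrames

open scoped BigOperators Topology Manifold Classical MeasureTheory ProbabilityTheory Matrix InnerProductSpace ComplexConjugate ContinuousMap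
open Filter Set Function TopologicalSpace MeasureTheory

attribute [summit_statement] _root_.QuantumAdvantage

open Literature.QuantumAdvantage

/-- item stmt-QuantumAdvantage-9861 · target · rank 0 · closed · moot by None · by planner
why it might fail: Hypothesis-type (DQC1 ⊄ BPP is open): it implies the summit, hence PP ⊄ BPP (SeparationPrerequisites); decision-DQC1 with 1/poly bias may sit in BPP even though multiplicative-error DQC1 SAMPLING is PH-hard (arXiv:1409.6777) — no trace estimator for general U is known, none is excluded.
sources: arXiv:quant-ph/9802037, arXiv:0707.2831, arXiv:1409.6777, arXiv:1711.10605, Literature.Barriers.QuantumAdvantage.SeparationPrerequisites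
[target] HYPOTHESIS-TYPE ("DQC1 ⊄ BPP", Knill–Laflamme 1998 / Shor–Jordan 2008 p.3 form): there are
a language L ∉ BPP, a register size k(x) and oracle-free Clifford+T circuits C_x on 1 + k(x) wires
with x ↦ ⟨1, k(x), C_x⟩ computable in FP (sigmaEncode, unary ancilla count ⇒ poly size), and a
polynomial q, such that the one-clean-qubit acceptance probability — wire 0 prepared |0⟩, wires
1…k(x) maximally mixed (uniform average over basis inputs r), run C_x, measure wire 0 — is ≥ 1/2 +
1/(q(|x|)+1) on x ∈ L and ≤ 1/2 − 1/(q(|x|)+1) on x ∉ L. Borrowed horn of card one-clean-qubit;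
never staffed for direct proof. -/
@[route_item "route-QuantumAdvantage-SeparableFrames"]
def OneCleanQubitHard : Prop :=
  ∃ L : Language Bool, (∃ (k : List Bool → ℕ) (C : (x : List Bool) → Literature.Computability.Cryptography.QCircuit Literature.Computability.Cryptography.cliffordT (1 + k x)), (∀ x, (C x).IsOracleFree) ∧ (fun x : List Bool => Literature.Computability.Cryptography.QCircuit.sigmaEncode (G := Literature.Computability.Cryptography.cliffordT) ⟨1, k x, C x⟩) ∈ Literature.Computability.Complexity.FP ∧ (∃ q : Polynomial ℕ, ∀ x : List Bool, (x ∈ L → (1 : ℝ) / 2 + 1 / (((q.eval x.length : ℕ) : ℝ) + 1) ≤ (∑ r : Literature.Computability.Cryptography.QReg (k x), ((1 : ℝ) / 2 ^ (k x)) * (C x).probEvent 0 (Literature.Computability.Cryptography.basisState (Fin.append (fun _ : Fin 1 => false) r)) (Literature.Computability.Cryptography.QCircuit.acceptEvent (1 + k x)))) ∧ (x ∉ L → (∑ r : Literature.Computability.Cryptography.QReg (k x), ((1 : ℝ) / 2 ^ (k x)) * (C x).probEvent 0 (Literature.Computability.Cryptography.basisState (Fin.append (fun _ : Fin 1 =>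 false) r)) (Literature.Computability.Cryptography.QCircuit.acceptEvent (1 + k x))) ≤ (1 : ℝ) / 2 - 1 / (((q.eval x.length : ℕ) : ℝ) + 1)))) ∧ L ∉ Literature.Computability.Complexity.BPP

/-- item stmt-QuantumAdvantage-9862 · crux · rank 2 · closed · moot by None · by planner
why it might fail: BBM's open dichotomy (1606.05283 p.8); DQC1 power is usually credited to discord not entanglement (0709.0548; DFC quant-ph/0505213 p.4: separable speed-up 'not demonstrated impossible'), so a hard fully-separable family is live; and the frame certificate leaks at n=2 (κ_2>1, CDH 1308.1737 Lem.10).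
sources: arXiv:1606.05283, arXiv:quant-ph/0505213, arXiv:0709.0548, arXiv:2411.18348, arXiv:quant-ph/0201143, arXiv:1308.1737
[crux] BOYER–BRODUTCH–MOR'S HORN (card K1 ∧ K2 ⟹ this; the mixed-state, one-clean-qubit counterpart
of the proved jozsaLinden2003_pblocked): for every polarization α ∈ [0,1], every FP-generated
oracle-free Clifford+T one-clean-qubit family (wire 0 prepared (1+α)/2·|0⟩⟨0| + (1−α)/2·|1⟩⟨1|,
wires 1…k(x) maximally mixed) ALL of whose trajectory states — every input x, after every prefix of
j gates — lie in the FULLY SEPARABLE cone (finite positive combinations of projectors onto product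
vectors, `IsPBlocked 1`) decides, with bias 1/poly around 1/2, only languages in BPP. "Every
separable instance of DQC1_α is classically easy"; equivalently every witness of OneCleanQubitHard
entangles its register at some prefix. [deps: TwoQubitFrameExactness, FactorTwoLemma] [difficulty:
open-problem] -/
@[route_item "route-QuantumAdvantage-SeparableFrames"]
def SeparableInstancesInBPP : Prop :=
  ∀ α : ℝ, 0 ≤ α → α ≤ 1 → ∀ (L : Language Bool) (k : List Bool → ℕ) (C : (x : List Bool) → Literature.Computability.Cryptography.QCircuit Literature.Computability.Cryptography.cliffordT (1 + k x)), (∀ x, (C x).IsOracleFree) → (fun x : List Bool => Literature.Computability.Cryptography.QCircuit.sigmaEncode (G := Literature.Computability.Cryptography.cliffordT) ⟨1, k x, C x⟩) ∈ Literature.Computability.Complexity.FP → (∀ (x : List Bool) (j : ℕ), (∃ (s : ℕ) (w : Fin s → ℝ) (φ : Fin s → Literature.Computability.Cryptography.QReg (1 + k x) → ℂ), (∀ i, 0 ≤ w i ∧ Literature.Barriers.QuantumAdvantage.IsPBlocked 1 (φ i)) ∧ (∑ b : Bool, ∑ r : Literature.Computability.Cryptography.QReg (k x), (((if b then 1 -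 α else 1 + α) / (2 * 2 ^ (k x)) : ℝ) : ℂ) • (fun ψ : Literature.Computability.Cryptography.QReg (1 + k x) → ℂ => Matrix.vecMulVec ψ (star ψ)) (Literature.Computability.Cryptography.QCircuit.runOn 0 (⟨((C x).gates.take j)⟩ : Literature.Computability.Cryptography.QCircuit Literature.Computability.Cryptography.cliffordT (1 + k x)) (Literature.Computability.Cryptography.basisState (Fin.append (fun _ : Fin 1 => b) r)))) = ∑ i, ((w i : ℂ) • Matrix.vecMulVec (φ i) (star (φ i))))) → (∃ q : Polynomial ℕ, ∀ x : List Bool, (x ∈ L → (1 : ℝ) / 2 + 1 / (((q.eval x.length : ℕ) : ℝ) + 1) ≤ (∑ b : Bool, ∑ r : Literature.Computability.Cryptography.QReg (k x), ((if b then 1 - α else 1 + α) / (2 * 2 ^ (k x))) * (C x).probEvent 0 (Literature.Computability.Cryptography.basisState (Fin.append (fun _ : Fin 1 => b) r)) (Literature.Computability.Cryptography.QCircuit.acceptEvent (1 + k x)))) ∧ (x ∉ L → (∑ b : Bool, ∑ r : Literature.Computability.Cryptography.QReg (k x), ((if b then 1 - α else 1 + α) / (2 * 2 ^ (k x))) *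 (C x).probEvent 0 (Literature.Computability.Cryptography.basisState (Fin.append (fun _ : Fin 1 => b) r)) (Literature.Computability.Cryptography.QCircuit.acceptEvent (1 + k x))) ≤ (1 : ℝ) / 2 - 1 / (((q.eval x.length : ℕ) : ℝ) + 1))) → L ∈ Literature.Computability.Complexity.BPP

/-- item stmt-QuantumAdvantage-11547 · crux · rank 3 · closed · moot by None · by planner
why it might fail: 𝒜 is ⊗-closed (1 + A⊗A′ = ½[(1+A)⊗(1+A′) + (1−A)⊗(1−A′)]), so the certified n = 2 gap tensorises: κ_2m ≥ (43/8)^m / h_𝒫(W^⊗m); unless adaptive trees gain collectively on copies of the X-state witness, κ_n ≥ 1.075^(n/2) (cf. generic SEP-vs-LOCC gaps, arXiv:1406.1959).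
sources: arXiv:0810.2327, arXiv:1206.2884, arXiv:1311.1536, arXiv:1308.1737, arXiv:1406.1959, arXiv:1606.05283
[crux] FRAME DILATION IS POLYNOMIAL (κ_n ≤ poly(n); card K1 fallback R — the strong form R= 'κ_n =
1' is REFUTED at n = 2 by Theorems/SeparableFramesTwoQubitFrameExactnessRefutation.lean, κ_2 ≥
43/40, and is NOT claimed). Witness form over the landed definitions: there is a polynomial p such
that for every n, every operator T on n qubits and every β > 0 with 1 + βT and 1 − βT both in
`fullySeparableCone n` (two-sided separable radius s_sym(T) ≥ β), T = Σ_m c_m D_m with every D_m ∈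
`treeDiagonalContractions n` (real-diagonal contractions Σ_y ε_y|e_y⟩⟨e_y|, |ε| ≤ 1, in an adaptive
LOCC-tree orthonormal product basis) and β·Σ_m|c_m| ≤ p(n), i.e. tree-frame norm a(T) ≤
p(n)/s_sym(T): the SEP body 𝒜_n = {A : 1 ± A separable} sits inside p(n)·𝒫_n. Known: κ_1 = 1, 43/40
≤ κ_2 ≤ 4, κ_n ≤ 4^n (Pauli ℓ1). Typed 2026-08-15 (repair), replacing the informal
stmt-QuantumAdvantage-9882. [deps: FactorTwoLemma] [difficulty: L] -/
@[route_item "route-QuantumAdvantage-SeparableFrames"]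
def FrameDilationPolynomial : Prop :=
  ∃ p : Polynomial ℕ, ∀ (n : ℕ) (T : Matrix (Literature.Computability.Cryptography.QReg n) (Literature.Computability.Cryptography.QReg n) ℂ) (β : ℝ), 0 < β → 1 + (β : ℂ) • T ∈ Literature.Computability.QuantumComplexity.fullySeparableCone n → 1 - (β : ℂ) • T ∈ Literature.Computability.QuantumComplexity.fullySeparableCone n → ∃ (K : ℕ) (c : Fin K → ℝ) (D : Fin K → Matrix (Literature.Computability.Cryptography.QReg n) (Literature.Computability.Cryptography.QReg n) ℂ), (∀ m, D m ∈ Literature.Computability.QuantumComplexity.treeDiagonalContractions n) ∧ T = ∑ m, ((c m : ℂ)) • D m ∧ β * ∑ m, |c m| ≤ ((p.eval n : ℕ) : ℝ)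

/-- item stmt-QuantumAdvantage-11548 · crux · rank 4 · closed · moot by None · by planner
why it might fail: Existence-only promise: light tree frames may exist along the trajectory yet be hard to FIND (tree bases are a non-convex family; planted instances), and prefix weight ≤ poly is weaker than the per-gate ℓ1 products Pauli-path samplers need (arXiv:2409.01706); the bet is gate-local re-framing.
sources: arXiv:1907.08224, arXiv:1606.05283, arXiv:quant-ph/0301108, arXiv:quant-ph/0201143, arXiv:2409.01706, arXiv:2306.04797
[crux] FRAME-LIGHT TRAJECTORIES ARE CLASSICALLY EASY (decision form of constructive frame tracking,
card K2 — the algorithm Boyer–Brodutch–Mor ask for; typed 2026-08-15, replacing the informal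
stmt-QuantumAdvantage-9893). For every polarization α ∈ [0,1], every language L and every
FP-generated oracle-free Clifford+T family C_x on 1 + k(x) wires (wire 0 the clean qubit, wires
1…k(x) maximally mixed, exactly the model of SeparableInstancesInBPP): IF there is a polynomial p
such that for every input x and every prefix j (first j gates V_j, `gates.take j`, run on basis
inputs b·r via `runOn`) the α-independent trajectory direction T_(x,j) := Σ_b Σ_r (−1)^b
|V_j(b·r)⟩⟨V_j(b·r)| (= V_j Z₀ V_j†; the trajectory state is (1 + α·T_(x,j))/2^(k+1)) is a real
combination Σ_m c_m D_m of `treeDiagonalContractions (1 + k x)` with Σ_m|c_m| ≤ p(|x|), THEN (if the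
family decides L at polarization α with bias 1/(q(|x|)+1) around 1/2, acceptance = wire 0 reads
true) L ∈ BPP. At α = 1 in the controlled-U architecture with weight-1 frames this is
Yoganathan–Cade's eigenvector-sampling simulation (arXiv:1907.08224 Thm 4.10); the claim extends it
to weight ≤ poly and any α, the machine having to FIND the -/
@[route_item "route-QuantumAdvantage-SeparableFrames"]
def FrameTrackingAlgorithm : Prop :=
  ∀ α : ℝ, 0 ≤ α → α ≤ 1 → ∀ (L : Language Bool) (k : List Bool → ℕ) (C : (x : List Bool) → Literature.Computability.Cryptography.QCircuit Literature.Computability.Cryptography.cliffordT (1 + k x)), (∀ x, (C x).IsOracleFree) → (fun x : List Bool => Literature.Computability.Cryptography.QCircuit.sigmaEncode (G := Literature.Computability.Cryptography.cliffordT) ⟨1, k x, C x⟩) ∈ Literature.Computability.Complexity.FP → (∃ p : Polynomial ℕ, ∀ (x : List Bool) (j : ℕ), ∃ (K : ℕ) (c : Fin K → ℝ) (D : Fin K → Matrix (Literature.Computability.Cryptography.QReg (1 + k x)) (Literature.Computability.Cryptography.QReg (1 + k x)) ℂ), (∀ m, D m ∈ Literature.Computability.QuantumComplexity.treeDiagonalContractions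 (1 + k x)) ∧ (∑ b : Bool, ∑ r : Literature.Computability.Cryptography.QReg (k x), ((if b then (-1 : ℝ) else 1) : ℂ) • (fun ψ : Literature.Computability.Cryptography.QReg (1 + k x) → ℂ => Matrix.vecMulVec ψ (star ψ)) (Literature.Computability.Cryptography.QCircuit.runOn 0 (⟨((C x).gates.take j)⟩ : Literature.Computability.Cryptography.QCircuit Literature.Computability.Cryptography.cliffordT (1 + k x)) (Literature.Computability.Cryptography.basisState (Fin.append (fun _ : Fin 1 => b) r)))) = ∑ m, ((c m : ℂ)) • D m ∧ ∑ m, |c m| ≤ ((p.eval x.length : ℕ) : ℝ)) → (∃ q : Polynomial ℕ, ∀ x : List Bool, (x ∈ L → (1 : ℝ) / 2 + 1 / (((q.eval x.length : ℕ) : ℝ) + 1) ≤ (∑ b : Bool, ∑ r : Literature.Computability.Cryptography.QReg (k x), ((if b then 1 - α else 1 + α) / (2 * 2 ^ (k x))) * (C x).probEvent 0 (Literature.Computability.Cryptography.basisState (Fin.append (fun _ : Fin 1 => b) r)) (Literature.Computability.Cryptography.QCircuit.acceptEvent (1 + k x)))) ∧ (x ∉ L → (∑ b : Bool, ∑ r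 : Literature.Computability.Cryptography.QReg (k x), ((if b then 1 - α else 1 + α) / (2 * 2 ^ (k x))) * (C x).probEvent 0 (Literature.Computability.Cryptography.basisState (Fin.append (fun _ : Fin 1 => b) r)) (Literature.Computability.Cryptography.QCircuit.acceptEvent (1 + k x))) ≤ (1 : ℝ) / 2 - 1 / (((q.eval x.length : ℕ) : ℝ) + 1))) → L ∈ Literature.Computability.Complexity.BPP

/-- item stmt-QuantumAdvantage-9864 · support · rank 9 · closed · moot by None · by planner
sources: arXiv:1606.05283, arXiv:quant-ph/0505213, doi:10.1103/PhysRevLett.83.1054, arXiv:quant-ph/0409095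
[support] FACTOR-2 TIGHTNESS (card P1, provable now): for every m, every operator U on m qubits and
every real α, with ρ_α(U) := (1/(2·2^m))·[[I, αU†],[αU, I]] (clean qubit = wire 0; the
trace-estimation state after H and controlled-U at polarization α) and T_θ := Re(e^(−iθ)U) =
(e^(−iθ)U + e^(iθ)U†)/2: (i) if I + 2α·T_θ is in the fully separable cone of m qubits for every θ
then ρ_α(U) is in the fully separable cone of m+1 qubits (proof: ρ_α(U) = ¼ Σ_(θ ∈ {0, π/2, π,
3π/2}) ½[|+n_θ⟩⟨+n_θ| ⊗ (I + 2αT_θ)/2^m + |−n_θ⟩⟨−n_θ| ⊗ (I − 2αT_θ)/2^m], n_θ equatorial, and I −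
2αT_θ = I + 2αT_(θ+π)); (ii) if ρ_α(U) is fully separable then I + α·T_θ is for every θ (project
wire 0 onto (|0⟩ + e^(iθ)|1⟩)/√2: local filtering keeps product vectors product). Hence 'separable
instance' ⟺ s_sym of every prefix direction ≥ α, up to the factor 2. [difficulty: provable-now] -/
@[route_item "route-QuantumAdvantage-SeparableFrames"]
def FactorTwoLemma : Prop :=
  ∀ (m : ℕ) (U : Matrix (Literature.Computability.Cryptography.QReg m) (Literature.Computability.Cryptography.QReg m) ℂ) (α : ℝ), ((∀ θ : ℝ, (∃ (s : ℕ) (w : Fin s → ℝ) (φ : Fin s → Literature.Computability.Cryptography.QReg (m) → ℂ), (∀ i, 0 ≤ w i ∧ Literature.Barriers.QuantumAdvantage.IsPBlocked 1 (φ i)) ∧ (1 + ((2 * α : ℝ) : ℂ) • (Matrix.of fun (a c : Literature.Computability.Cryptography.QReg m) => (Complex.exp (-((θ : ℂ) * Complex.I)) * U a c + star (Complex.exp (-((θ : ℂ) * Complex.I)) * U c a)) / 2)) = ∑ i, ((w i : ℂ) • Matrix.vecMulVec (φ i) (star (φ i))))) → (∃ (s : ℕ) (w : Fin s → ℝ)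 (φ : Fin s → Literature.Computability.Cryptography.QReg (m + 1) → ℂ), (∀ i, 0 ≤ w i ∧ Literature.Barriers.QuantumAdvantage.IsPBlocked 1 (φ i)) ∧ ((Matrix.of fun (y z : Literature.Computability.Cryptography.QReg (m + 1)) => ((1 : ℂ) / (2 * 2 ^ m)) * (if y 0 = z 0 then (if Fin.tail y = Fin.tail z then (1 : ℂ) else 0) else if y 0 = true then (α : ℂ) * U (Fin.tail y) (Fin.tail z) else (α : ℂ) * star (U (Fin.tail z) (Fin.tail y))))) = ∑ i, ((w i : ℂ) • Matrix.vecMulVec (φ i) (star (φ i))))) ∧ ((∃ (s : ℕ) (w : Fin s → ℝ) (φ : Fin s → Literature.Computability.Cryptography.QReg (m + 1) → ℂ), (∀ i, 0 ≤ w i ∧ Literature.Barriers.QuantumAdvantage.IsPBlocked 1 (φ i)) ∧ ((Matrix.of fun (y z : Literature.Computability.Cryptography.QReg (m + 1)) => ((1 : ℂ) / (2 * 2 ^ m)) * (if y 0 = z 0 then (if Fin.tail y = Fin.tail z then (1 : ℂ) else 0) else if y 0 = true then (α : ℂ) * U (Fin.tail y) (Fin.tail z) else (α : ℂ) * star (U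 (Fin.tail z) (Fin.tail y))))) = ∑ i, ((w i : ℂ) • Matrix.vecMulVec (φ i) (star (φ i)))) → ∀ θ : ℝ, (∃ (s : ℕ) (w : Fin s → ℝ) (φ : Fin s → Literature.Computability.Cryptography.QReg (m) → ℂ), (∀ i, 0 ≤ w i ∧ Literature.Barriers.QuantumAdvantage.IsPBlocked 1 (φ i)) ∧ (1 + (α : ℂ) • (Matrix.of fun (a c : Literature.Computability.Cryptography.QReg m) => (Complex.exp (-((θ : ℂ) * Complex.I)) * U a c + star (Complex.exp (-((θ : ℂ) * Complex.I)) * U c a)) / 2)) = ∑ i, ((w i : ℂ) • Matrix.vecMulVec (φ i) (star (φ i)))))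

/-- item stmt-QuantumAdvantage-9865 · support · rank 9 · closed · moot by None · by planner
sources: arXiv:quant-ph/9802037, arXiv:0707.2831, arXiv:1212.0506, BernsteinVazirani1997
[support] THE BRIDGE (DQC1 ⊆ BQP, Knill–Laflamme 1998; Shor–Jordan 2008 §1): every language decided
in the one-clean-qubit model of the target (FP-generated oracle-free Clifford+T circuits, wire 0
clean, maximally mixed register, bias 1/poly around 1/2) is in `BQP`: a poly-time uniform family
reads x, computes the description of C_x reversibly (P ⊆ BQP compilation), prepares k(x) maximally
mixed wires as halves of Bell pairs (H + CNOT on fresh ancillas), applies C_x through a universal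
circuit whose controlled-H / controlled-T / Fredkin gadgets are EXACT over Clifford+T with ancillas
(Giles–Selinger: entries in ℤ[1/√2, i]), repeats O(q(n)²) copies in parallel and takes a majority
(Chernoff) to reach error ≤ 1/3. A theorem; XL to formalise; shares infrastructure with route Shor's
P ⊆ BQP crux. [difficulty: XL] -/
@[route_item "route-QuantumAdvantage-SeparableFrames"]
def OneCleanQubitInBQP : Prop :=
  ∀ L : Language Bool, (∃ (k : List Bool → ℕ) (C : (x : List Bool) → Literature.Computability.Cryptography.QCircuit Literature.Computability.Cryptography.cliffordT (1 + k x)), (∀ x, (C x).IsOracleFree) ∧ (fun x : List Bool => Literature.Computability.Cryptography.QCircuit.sigmaEncode (G := Literature.Computability.Cryptography.cliffordT) ⟨1, k x, C x⟩) ∈ Literature.Computability.Complexity.FP ∧ (∃ q : Polynomial ℕ, ∀ x : List Bool, (x ∈ L → (1 : ℝ) / 2 + 1 / (((q.eval x.length : ℕ) : ℝ) + 1) ≤ (∑ r : Literature.Computability.Cryptography.QReg (k x), ((1 : ℝ) / 2 ^ (k x)) * (C x).probEvent 0 (Literature.Computability.Cryptography.basisState (Fin.append (fun _ : Fin 1 =>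 false) r)) (Literature.Computability.Cryptography.QCircuit.acceptEvent (1 + k x)))) ∧ (x ∉ L → (∑ r : Literature.Computability.Cryptography.QReg (k x), ((1 : ℝ) / 2 ^ (k x)) * (C x).probEvent 0 (Literature.Computability.Cryptography.basisState (Fin.append (fun _ : Fin 1 => false) r)) (Literature.Computability.Cryptography.QCircuit.acceptEvent (1 + k x))) ≤ (1 : ℝ) / 2 - 1 / (((q.eval x.length : ℕ) : ℝ) + 1)))) → L ∈ Literature.Computability.Cryptography.BQP

/-- item stmt-QuantumAdvantage-9866 · assembly · rank 1 · closed · moot by None · by planner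
sources: arXiv:quant-ph/9802037, arXiv:0707.2831
[assembly] OneCleanQubitHard → OneCleanQubitInBQP → QuantumAdvantage. -/
@[route_item "route-QuantumAdvantage-SeparableFrames"]
def Assembly : Prop :=
  OneCleanQubitHard → OneCleanQubitInBQP → QuantumAdvantage

-- records of items no longer active in this route (dropped / restated):
-- earlier TwoQubitFrameExactness (stmt-QuantumAdvantage-9863, dropped 2026-08-15T18:22:53Z): refuted by Summit.QuantumAdvantage.QuantumAdvantage.Theorems.SeparableFramesTwoQubitFrameExactness_refuted @ f92389067068 — ∀ A : Matrix (Literature.Computability.Cryptography.QReg 2) (Literature.Computability.Cryptography.QReg 2) ℂ, A.IsHermitian → (((∃ (s : ℕ) (w : Fin s → ℝ) (φ : Fin s → Literature.Comput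

end Summit.QuantumAdvantage.QuantumAdvantage.Theses.SeparableFrames
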